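import Summits.AtomisticToContinuum.BoseEinsteinCondensation.Theses.BECStronglyRayleigh
import Summits.AtomisticToContinuum.BoseEinsteinCondensation.Theorems.LatticeODLROOffHalfFilling.Negative.OffHalfFillingPrelim
import Summits.AtomisticToContinuum.BoseEinsteinCondensation.Theorems.InsertionFieldDelocalisation.Negative.PerronExistence

/-!
# Disproof of `KineticLatticeBEC` — findings (cdisprove seat, crux stmt-AtomisticToContinuum-9671)

Standing-adversary work file for the TARGET of route `BECStronglyRayleigh` (rank 0; verbatim the shared
signature of `UniformLatticeBEC`, stmt-5008): `∃ c > 0, ∃ L₀, ∀ even L ≥ L₀, ∀ 1 ≤ N ≤ L³/2,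
c·N·L³ ≤ Re ω_{H_pen(L,N)}((S¹_tot)² + (S²_tot)²) + N − L³/2`, with
`H_pen(L,N) = xyTorus 3 L 1 + 4L³•(S³_tot + (L³/2 − N)•1)²` and `ω` the tracial ground state.
Everything below is `lean check`ed, sorry-free, axioms `{propext, Classical.choice, Quot.sound}`.
VERDICT (cycle 1): **no kill; the statement resists** — it is the faithful finite-volume form of
"RP-free BEC of 3-D hard-core lattice bosons, uniformly at every filling `≤ ½`", the open problem of
LSSY2005 Ch. 11 / ALSSY2004, believed TRUE. What the adversary CAN certify is below.
LANDED (importable, namespace `…Theorems.KineticLatticeBEC.Negative`): `Negative/Toolkit.lean` (§0–§1,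
p85344), `Negative/FullFilling.lean` (§2, p89267), `Negative/CasimirCeiling.lean` (§3, p88238),
`Negative/ParticleHole.lean` (§4, p89275), `Negative/SectorSelection.lean` (§5, p90037) and
`Negative/HoleCap.lean` (§5 hole caps, §6 helpers minus the positive reduction, §7; p90688).

## Findings (index)

* §0 READ-BACK. `kineticLatticeBEC_iff : KineticLatticeBEC ↔ ∃ c > 0, ∃ L₀, KineticLatticeBECWith c L₀`
  (`Iff.rfl`), with `rhs L N = Re ω(O) + N − L³/2`, `O = obsO = (S¹_tot)²+(S²_tot)²`. Typing audit:
  `xyTorus 3 L 1 = −Σ_{bonds} hop` is the FERROMAGNETIC XY model = hard-core bosons with hopping `½`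
  (`xyTorus_eq_Hmu_zero`, the in-tree KLS sign); spin-½ index `0 = ↑ = occupied`, `S⁺_x = E x`;
  `obsO_eq : O = (S⁺_tot)ᴴS⁺_tot + S³_tot`, so in the `N`-sector `rhs = ω(S⁺_totS⁻_tot) = Σ_{x,y}
  ⟨b†_x b_y⟩ = L³·N₀` and the crux is `N₀ ≥ cN`; `H_pen`, `O` Hermitian (`Hpen_isHermitian`), `ω` an
  honest state (`groundStateFunctional_one`, `re_gsf_nonneg_of_groundSpace`), no junk values reachable
  (`L ≥ L₀` with `L₀` free, `N ≥ 1`). Quantifier order `∃c ∃L₀ ∀L ∀N` is the intended UNIFORM one.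
* §1 MASTER INEQUALITY (★) `re_quad_Hpen_ge`: for `L ≥ 3`, all `N`, all `v`,
  `Σ_σ [4L³(L³ − N − #↓σ)² − 3·#↓σ] |v_σ|² ≤ Re⟨v, H_pen v⟩` — the saturation SOS certificate
  `H_XY + 3N↓ = ½Σ|S⁺_x − S⁺_{x+eᵢ}|² ≥ 0` (`hmu_decomp` of the sibling disproof of
  `LatticeODLROOffHalfFilling`, imported) plus the DIAGONAL penalty `(pen v)(σ) = (n_up(σ) − N)v(σ)`
  (`pen_mulVec_apply`). Consequences: `Hpen_mulVec_upVec` (`|⇑⟩` is an eigenvector, eigenvalue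
  `4L³(L³−N)²`), `groundEnergy_Hpen_le`.
* §2 (a) LOAD-BEARING HYPOTHESIS `2N ≤ L³`: `kineticLatticeBEC_false_without_halfFilling :
  ¬ KineticLatticeBECWithoutHalfFilling` — relax to `N ≤ L³` and the statement is FALSE. Witness `N = L³` (full
  filling): the ground space of `H_pen(L,L³)` is the ray `ℂ|⇑⟩` (`eq_smul_upVec_of_mem_groundSpace_full`,
  from (★)), `Re ω(O) ≤ L³/2` (`re_gsf_obsO_full_le`), `rhs(L,L³) ≤ L³ = N` (`rhs_full_le`: `N₀ ≤ 1`),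
  so `c L³ ≤ 1` on every even torus — impossible. By particle–hole symmetry `N₀(N) = N₀(L³−N) +
  (2N−L³)/L³`, so `N₀/N → 0` along `N/L³ → 1`: a proof must use the filling cap (any cap `N ≤ (1−δ)L³`
  would do physically; the crux fixes `δ = ½`, where KLS applies at the endpoint).
  Other hypotheses: `Even L` — NOT load-bearing for truth (odd tori are expected to condense too; it is
  an RP artefact inherited from `UniformLatticeBEC`), possibly unnecessary; `1 ≤ N` — harmless (`N = 0`
  reads `0 ≤ rhs(L,0) = 0`); `L₀` — absorbs small tori only (each fixed `L` holds with its own `c_L > 0`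
  by Perron positivity), so the content is `inf_{L,N} N₀/N > 0`.
* §3 (b) TIGHTNESS `constant_le_half : KineticLatticeBECWith c L₀ → c ≤ ½`, from the Casimir /
  Tóth ceiling `re_quad_obsO_le : Re⟨v, O v⟩ ≤ (|Λ|²/4 + |Λ|/2)‖v‖²` for EVERY vector (Cauchy–Schwarz
  + double counting `sum_flip`; `normSq_sumE_mulVec_sum_le : ‖S⁺_tot v‖² ≤ Σ_τ #↓τ(|Λ|−#↓τ+1)|v_τ|²`
  is Tóth1991's `λ_max(γ_N) ≤ N(|Λ|−N+1)/|Λ|` before restricting to a sector), whence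
  `rhs_le : rhs L N ≤ L⁶/4 + N` and at half filling `c ≤ ½ + 1/L³`. Spin-wave theory / QMC for the
  3-D quantum XY model give an order parameter `m ≈ 0.45` of saturation `½`, i.e. `N₀/N = 2m² ≈ 0.4`
  at half filling: the ceiling is nearly saturated, the crux is plausible only with `c < ½`, and the route's own constant is `c = 1/max(M,1) ≤ ¼` (sibling `four_le_const`).
* §3 (c) REFUTED STRENGTHENINGS: `not_kineticLatticeBECWith_of_half_lt` (any `c > ½`),
  `not_kineticLatticeBECWith_one` ("no depletion", `N₀ ≥ N`), and (a) above ("every filling").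
  Not decidable here: no finite-`L` instance refutes an `∃ L₀` statement; `d = 1` (false, Tonks
  `N₀ ~ √N`) and `d = 2` are not instances (the dimension is the literal `3`).
* §4 PARTICLE–HOLE SYMMETRY (flip `U = ⨂σˣ`: `flip_conj_obsO`, `flip_conj_Hpen`, covariance of
  the tracial state): `rhs_particle_hole : rhs(L,N) = rhs(L,L³−N) + 2N − L³` (`N₀(N) = N₀(L³−N) +
  (2N−L³)/L³`). Consequence `kineticLatticeBEC_iff_cap : KineticLatticeBEC ↔ KineticLatticeBECCap δ`
  for every `0 < δ ≤ ½` (cap `N ≤ (1−δ)L³`, constant `cδ`): the RP-born threshold `½` carries NO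
  information — uniform BEC up to any fixed fraction of full filling is the same statement.
* §5 SECTOR SELECTION & TÓTH. `apply_eq_zero_of_mem_groundSpace`: for `L ≥ 3`, `N ≤ L³` every
  ground vector of `H_pen(L,N)` is supported in the sector `n_up = N` (block-diagonality
  `Hpen_apply_eq_zero_of_downCount_ne` + diagonal `Hpen_apply_self` ⇒ `E₀ ≤ 0`
  (`groundEnergy_Hpen_nonpos`) + off-sector block `≥ L³` by (★)) — the vector form of the `d = 3`
  case of support item `PenaltySelectsSector` (provers: this is 80 lines here). Hence the route's
  reading `rhs = ω(S⁺_totS⁻_tot) = L³N₀` IS exact, and TÓTH'S BOUND `rhs_le_toth : rhs(L,N) ≤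
  N(L³ − N + 1)` (Tóth1991, `λ_max(γ_N) ≤ N(|Λ|−N+1)/|Λ|`; in-sector Casimir
  `re_quad_obsO_le_of_support`), sharp at `N = 1`. With §4: `kineticLatticeBEC_false_withHoleCap K :
  ¬ KineticLatticeBECWithHoleCap K` for EVERY fixed `K` (cap `N + K ≤ L³`; `K = 0` is §2): the filling hypothesis is
  load-bearing exactly at linear order in `L³`.
* §6 FOR THE PROVERS (work file only): in the sector `Re⟨v,Ov⟩ = ‖S⁺_tot v‖² + (N − L³/2)‖v‖²`
  (`re_quad_obsO_eq_of_support`); lower-bound transfer `le_rhs_of_groundSpace_bound`; and the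
  sufficient condition `kineticLatticeBEC_of_groundVector_bound`: a uniform bound
  `(cNL³ + L³ − 2N)‖v‖² ≤ ‖S⁺_tot v‖²` over ground vectors of `H_pen(L,N)` closes the crux (the converse
  needs Perron uniqueness, support item `SectorGroundStatePerron`).
* §7 `1 ≤ N` is NOT load-bearing: `rhs_full : rhs(L,L³) = L³`, `rhs_zero : rhs(L,0) = 0`,
  `crux_ineq_zero` (the `N = 0` instance reads `0 ≤ 0`).
* NUMERICS (exact diagonalisation, kit job j013112, `N`-sector Lanczos of `−Σ_{edges}½(b†b + h.c.)` on
  `(ℤ/Lℤ)³`; columns `L N : N₀/N [Tóth ceiling (L³−N+1)/L³]`): `2 1 : 1 [1]`, `2 2 : .854 [.875]`,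
  `2 3 : .723 [.750]`, `2 4 : .594 [.625]` (half filling); `3 2…6 : .955 .912 .871 .830 .791
  [.963 .926 .889 .852 .815]`; `4 1…4 : 1 .980 .960 .940 [1 .984 .969 .953]`; `5 2,3 : .988 .977
  [.992 .984]`; `6 2,3 : .993 .986 [.995 .991]` (`4 5` exceeded the 4 GB lane cap). At every computed
  point `N₀/N` sits `0.003–0.03` BELOW Tóth's kinematic ceiling and far above `0`: the dilute end is
  harmless (`N₀ → N`), and the binding constraint for `c` is half filling (`≈ 0.4` expected as `L → ∞`,
  `0.594` at `L = 2`).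
* (d) TARGETS: none yet (`stuck_stubs = []`, no line picked).
* (e) WHY IT RESISTS. A refutation must exhibit `c_k → 0`: even tori `L_k → ∞` and fillings
  `N_k ≤ L_k³/2` with `N₀(N_k,L_k)/N_k → 0`, i.e. ABSENCE of uniform condensation for the 3-D
  hard-core Bose gas at `T = 0` somewhere in `(0, ½]` — against spin-wave theory, QMC and the KLS
  theorem at the endpoint `½` (`kennedy_lieb_shastry_xy_ground_holds` in tree gives `N₀ ≥ 2·0.032·N`
  there, LSSY2005 (11.26)); the dilute end `N = O(1)` is few-body (`N₀ → N`), and intermediate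
  fillings have no known obstruction (Mermin–Wagner / Pitaevskii–Stringari bite only for `d ≤ 2`,
  `T > 0` / `d = 1`). The formal escape hatches (sign of `J`, spin index convention, penalty strength
  `4L³ >` spectral width `3L³`, junk values of `groundEnergy`/`trace`, `.re`) are closed by §0–§1.
  FOR THE PROVERS: (i) any proof must use a filling cap linear in `L³` (§2, §5) — but which fraction
  is immaterial (§4) — and cannot give `c > ½` (§3), nor `N₀ > N(L³−N+1)/L³` at any filling (§5);
  (ii) sector selection for the penalised Hamiltonian is settled here in vector form (§5), so
  `rhs(L,N) = ‖S⁺_tot ψ‖²/‖ψ‖² + N − L³/2` for the sector ground ray (`quad_obsO`,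
  `apply_eq_zero_of_mem_groundSpace`) — the form in which Tóth's cycle representation and the route's
  pair-insertion field both enter; (iii) by §4 it suffices to treat `N ≤ L³/2` with ANY method and the
  mirror fillings follow with constant `c/2`.
-/

noncomputable section

namespace Summit.AtomisticToContinuum.BoseEinsteinCondensation.Cruxes.KineticLatticeBEC.Disproof

open scoped BigOperators ComplexOrder
open Literature.MathematicalPhysics.QuantumLattice Literature.Probability.LatticeModels Matrix Finset
open Summit.AtomisticToContinuum.BoseEinsteinCondensation.Theses.BECStronglyRayleigh
open Summit.AtomisticToContinuum.BoseEinsteinCondensation.Theorems.LatticeODLROOffHalfFilling.Negative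

/-! ### §0 The crux, verbatim pieces -/

section Defs

variable (L : ℕ) [NeZero L]

/-- The penalised XY Hamiltonian of the crux (verbatim the matrix fed to `groundStateFunctional`):
`H_pen(L,N) = xyTorus 3 L 1 + 4L³ • (S³_tot + (L³/2 − N)•1)²`. [folklore] -/
abbrev Hpen (N : ℕ) : Op (TorusSite 3 L) 2 :=
  xyTorus 3 L 1 + (((3 + 1) * L ^ 3 : ℕ) : ℂ) •
    (totalSpin 1 2 + ((L : ℂ) ^ 3 / 2 - (N : ℂ)) • (1 : Op (TorusSite 3 L) 2)) ^ 2

/-- The crux's observable `(S¹_tot)² + (S²_tot)²` (verbatim). [folklore] -/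
abbrev obsO (Λ : Type*) [Fintype Λ] [DecidableEq Λ] : Op Λ 2 :=
  totalSpin 1 0 * totalSpin 1 0 + totalSpin 1 1 * totalSpin 1 1

/-- The right-hand side of the crux inequality: `Re ω_{H_pen(L,N)}((S¹_tot)²+(S²_tot)²) + N − L³/2`
(`= ω(S⁺_tot S⁻_tot) = L³ ·` zero-mode occupation when the ground state lies in the `N`-boson
sector). [folklore] -/
def rhs (N : ℕ) : ℝ :=
  ((Hpen L N).groundStateFunctional (obsO (TorusSite 3 L))).re + N - (L : ℝ) ^ 3 / 2

end Defs

/-- The crux with its two existential parameters exposed. -/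
def KineticLatticeBECWith (c : ℝ) (L₀ : ℕ) : Prop :=
  ∀ (L : ℕ) [NeZero L], L₀ ≤ L → Even L → ∀ N : ℕ, 1 ≤ N → 2 * N ≤ L ^ 3 →
    c * N * (L : ℝ) ^ 3 ≤ rhs L N

/-- READ-BACK: the crux is literally `∃ c > 0, ∃ L₀, KineticLatticeBECWith c L₀`. [folklore] -/
theorem kineticLatticeBEC_iff :
    KineticLatticeBEC ↔ ∃ c : ℝ, 0 < c ∧ ∃ L₀ : ℕ, KineticLatticeBECWith c L₀ :=
  Iff.rfl

section Basics

variable (L : ℕ) [NeZero L]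

/-- `|Λ| = L³` on the three-dimensional torus. [folklore] -/
theorem card_site : Fintype.card (TorusSite 3 L) = L ^ 3 := by
  simp [TorusSite, ZMod.card]

/-- The XY torus Hamiltonian is the `μ = 0` member of the saturation family `Hmu`. [folklore] -/
theorem xyTorus_eq_Hmu_zero : xyTorus 3 L 1 = Hmu L 0 := by
  simp [Hmu, xyTorus]

/-- The penalty operator `S³_tot + (L³/2 − N)•1` is Hermitian. [folklore] -/
theorem pen_isHermitian (N : ℕ) :
    (totalSpin 1 2 + ((L : ℂ) ^ 3 / 2 - (N : ℂ)) • (1 : Op (TorusSite 3 L) 2)).IsHermitian := by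
  refine (totalSpin_isHermitian 1 2).add ?_
  have : ((L : ℂ) ^ 3 / 2 - (N : ℂ)) = (((L : ℝ) ^ 3 / 2 - (N : ℝ) : ℝ) : ℂ) := by push_cast; ring
  rw [this]
  exact isHermitian_one.ofReal_smul _
  where
  /-- helper: real scalar multiples of Hermitian matrices are Hermitian -/
  isHermitian_one : (1 : Op (TorusSite 3 L) 2).IsHermitian := Matrix.isHermitian_one

/-- `H_pen(L,N)` is Hermitian. [folklore] -/
theorem Hpen_isHermitian (N : ℕ) : (Hpen L N).IsHermitian := by
  refine (xxzHamiltonian_isHermitian 1 _ (-1) 0).add ?_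
  have h2 : ((totalSpin 1 2 + ((L : ℂ) ^ 3 / 2 - (N : ℂ)) • (1 : Op (TorusSite 3 L) 2)) ^ 2).IsHermitian :=
    (pen_isHermitian L N).pow 2
  have : (((3 + 1) * L ^ 3 : ℕ) : ℂ) = ((((3 + 1) * L ^ 3 : ℕ) : ℝ) : ℂ) := by push_cast; ring
  rw [this]
  exact h2.ofReal_smul _

end Basics


/-! ### §1 The master inequality: the quadratic form of `H_pen` in the configuration basis -/

section Master

variable {Λ : Type*} [Fintype Λ] [DecidableEq Λ]

/-- `(N↓ v)(σ) = (#↓σ) · v(σ)`: the down-spin number operator is diagonal. [folklore] -/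
theorem sumPd_mulVec_apply (v : TensorIndex Λ 2 → ℂ) (σ : TensorIndex Λ 2) :
    ((∑ x : Λ, Pd x) *ᵥ v) σ = (downCount σ : ℂ) * v σ := by
  rw [Matrix.sum_mulVec, Finset.sum_apply]
  simp_rw [Pd_mulVec_apply]
  rw [Finset.sum_ite, Finset.sum_const_zero, add_zero, Finset.sum_const, nsmul_eq_mul, downCount]

/-- `⟨v, N↓ v⟩ = Σ_σ (#↓σ) ‖v σ‖²`. [folklore] -/
theorem quad_sumPd (v : TensorIndex Λ 2 → ℂ) :
    star v ⬝ᵥ (∑ x : Λ, Pd x) *ᵥ v = ((∑ σ, (downCount σ : ℝ) * ‖v σ‖ ^ 2 : ℝ) : ℂ) := by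
  rw [dotProduct]
  push_cast
  refine Finset.sum_congr rfl fun σ _ => ?_
  rw [Pi.star_apply, sumPd_mulVec_apply, Complex.star_def, ← Complex.conj_mul']
  ring

variable (L : ℕ) [NeZero L]

/-- The penalty operator of the crux, `S³_tot + (L³/2 − N)•1` (`= n_up − N`, diagonal). [folklore] -/
abbrev pen (N : ℕ) : Op (TorusSite 3 L) 2 :=
  totalSpin 1 2 + ((L : ℂ) ^ 3 / 2 - (N : ℂ)) • (1 : Op (TorusSite 3 L) 2)

/-- `H_pen = H_XY + 4L³ • pen²` (definitional). [folklore] -/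
theorem Hpen_eq (N : ℕ) :
    Hpen L N = xyTorus 3 L 1 + (((3 + 1) * L ^ 3 : ℕ) : ℂ) • pen L N ^ 2 := rfl

/-- **The penalty is diagonal**: `(pen v)(σ) = (L³ − N − #↓σ) v(σ) = (n_up(σ) − N) v(σ)`. [folklore] -/
theorem pen_mulVec_apply (N : ℕ) (v : TensorIndex (TorusSite 3 L) 2 → ℂ) (σ : TensorIndex (TorusSite 3 L) 2) :
    (pen L N *ᵥ v) σ = ((L : ℂ) ^ 3 - N - downCount σ) * v σ := by
  rw [add_mulVec, smul_mulVec, one_mulVec, Pi.add_apply, Pi.smul_apply, smul_eq_mul,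
    totalSpin_two_eq, sub_mulVec, smul_mulVec, one_mulVec, Pi.sub_apply, Pi.smul_apply,
    smul_eq_mul, sumPd_mulVec_apply, card_site]
  push_cast
  ring

/-- `⟨v, pen² v⟩ = Σ_σ (L³ − N − #↓σ)² ‖v σ‖²`. [folklore] -/
theorem quad_penSq (N : ℕ) (v : TensorIndex (TorusSite 3 L) 2 → ℂ) :
    star v ⬝ᵥ (pen L N ^ 2) *ᵥ v =
      ((∑ σ, ((L : ℝ) ^ 3 - N - downCount σ) ^ 2 * ‖v σ‖ ^ 2 : ℝ) : ℂ) := by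
  rw [pow_two, ← mulVec_mulVec, dotProduct]
  push_cast
  refine Finset.sum_congr rfl fun σ _ => ?_
  rw [Pi.star_apply, pen_mulVec_apply, pen_mulVec_apply, Complex.star_def, ← Complex.conj_mul']
  ring

/-- **Kinetic energy versus down-spin number**: `Re⟨v, H_XY v⟩ ≥ −3 Σ_σ (#↓σ)‖v σ‖²`, i.e.
`H_XY + 3N↓ ≥ 0` — the saturation certificate `hmu_decomp` at `μ = 0`. [folklore] -/
theorem re_quad_xy_ge (hL : 3 ≤ L) (v : TensorIndex (TorusSite 3 L) 2 → ℂ) :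
    -(3 * ∑ σ, (downCount σ : ℝ) * ‖v σ‖ ^ 2) ≤ (star v ⬝ᵥ (xyTorus 3 L 1) *ᵥ v).re := by
  rw [xyTorus_eq_Hmu_zero, hmu_decomp L hL 0]
  rw [add_mulVec, add_mulVec, dotProduct_add, dotProduct_add, Complex.add_re, Complex.add_re,
    smul_mulVec, smul_mulVec, smul_mulVec, one_mulVec, dotProduct_smul, dotProduct_smul,
    dotProduct_smul, smul_eq_mul, smul_eq_mul, smul_eq_mul, Complex.re_ofReal_mul,
    Complex.re_ofReal_mul, Complex.re_ofReal_mul, quad_sumPd, Complex.ofReal_re]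
  have hsos : 0 ≤ (star v ⬝ᵥ (∑ x : TorusSite 3 L, ∑ i : Fin 3,
      (E x - E (x + Pi.single i 1))ᴴ * (E x - E (x + Pi.single i 1))) *ᵥ v).re := by
    rw [Matrix.sum_mulVec, dotProduct_sum, Complex.re_sum]
    refine Finset.sum_nonneg fun x _ => ?_
    rw [Matrix.sum_mulVec, dotProduct_sum, Complex.re_sum]
    refine Finset.sum_nonneg fun i _ => ?_
    rw [star_dotProduct_conjTranspose_mul_mulVec]
    exact (Complex.nonneg_iff.mp (dotProduct_star_self_nonneg _)).1
  have h0 : -(0 * (Fintype.card (TorusSite 3 L) : ℝ) / 2) * (star v ⬝ᵥ v).re = 0 := by ring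
  rw [h0, zero_add]
  nlinarith [hsos]

/-- **MASTER INEQUALITY (★).** For `L ≥ 3`, every `N` and every vector `v`:
`Σ_σ [4L³(L³ − N − #↓σ)² − 3·#↓σ] ‖v σ‖² ≤ Re⟨v, H_pen(L,N) v⟩`.
The bracket is `4L³(n_up(σ) − N)² − 3(L³ − n_up(σ))`: at least `L³ > 0` off the `N`-sector, and
`−3(L³ − N) ≤ 0` on it. Every finding below is read off this one line. [folklore] -/
theorem re_quad_Hpen_ge (hL : 3 ≤ L) (N : ℕ) (v : TensorIndex (TorusSite 3 L) 2 → ℂ) :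
    ∑ σ, (4 * (L : ℝ) ^ 3 * ((L : ℝ) ^ 3 - N - downCount σ) ^ 2 - 3 * downCount σ) * ‖v σ‖ ^ 2 ≤
      (star v ⬝ᵥ (Hpen L N) *ᵥ v).re := by
  have h1 := re_quad_xy_ge L hL v
  have hc : (((3 + 1) * L ^ 3 : ℕ) : ℂ) = ((4 * (L : ℝ) ^ 3 : ℝ) : ℂ) := by push_cast; ring
  rw [Hpen_eq, add_mulVec, dotProduct_add, Complex.add_re, smul_mulVec, dotProduct_smul,
    smul_eq_mul, hc, quad_penSq, ← Complex.ofReal_mul, Complex.ofReal_re]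
  have hsplit : ∑ σ, (4 * (L : ℝ) ^ 3 * ((L : ℝ) ^ 3 - N - downCount σ) ^ 2 - 3 * downCount σ) *
      ‖v σ‖ ^ 2 = 4 * (L : ℝ) ^ 3 * ∑ σ, ((L : ℝ) ^ 3 - N - downCount σ) ^ 2 * ‖v σ‖ ^ 2 -
        3 * ∑ σ, (downCount σ : ℝ) * ‖v σ‖ ^ 2 := by
    rw [Finset.mul_sum, Finset.mul_sum, ← Finset.sum_sub_distrib]
    refine Finset.sum_congr rfl fun σ _ => ?_
    ring
  rw [hsplit]
  linarith

end Master


/-! ### §2 (a) LOAD-BEARING: the half-filling restriction `2N ≤ L³`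

Relax `2 * N ≤ L ^ 3` to `N ≤ L ^ 3` (BEC "at every filling") and the statement is FALSE: at full
filling `N = L³` the ground space of `H_pen` is the ray of the all-up vector `|⇑⟩` (zero bosonic
holes), where `⟨S⁺_totS⁻_tot⟩ = L³ = N`, i.e. `N₀ = 1`, so `c·N·L³ ≤ N` forces `c L³ ≤ 1`.
(Particle–hole symmetry `N ↔ L³ − N` gives `N₀(N) = N₀(L³−N) + (2N − L³)/L³`, so near full
filling `N₀/N → 0`: the restriction to fillings `≤ ½` is exactly what makes uniformity in `N`
possible.) -/

section FullFilling

variable {Λ : Type*} [Fintype Λ] [DecidableEq Λ]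

omit [DecidableEq Λ] in
/-- A configuration has no down spin iff it is the all-up configuration. [folklore] -/
theorem downCount_eq_zero_iff (σ : TensorIndex Λ 2) : downCount σ = 0 ↔ σ = fun _ => 0 := by
  rw [downCount, Finset.card_eq_zero, Finset.filter_eq_empty_iff]
  constructor
  · intro h
    funext x
    have hx := h (Finset.mem_univ x)
    rcases Fin.exists_fin_two.mp ⟨σ x, rfl⟩ with h0 | h1
    · exact h0
    · exact absurd h1 hx
  · rintro rfl x _
    simp

/-- `(S¹_tot)² + (S²_tot)² = Σ_{x,y} (S¹_xS¹_y + S²_xS²_y)`. [folklore] -/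
theorem obsO_eq_sum_hop : obsO Λ = ∑ x : Λ, ∑ y : Λ, hop x y := by
  simp only [obsO, totalSpin, Finset.sum_mul_sum, hop, Finset.sum_add_distrib]

/-- **The order-parameter operator of the crux**: `(S¹_tot)² + (S²_tot)² = (S⁺_tot)ᴴ S⁺_tot + S³_tot`
with `S⁺_tot = Σ_x E x` (so `RHS = ω((S¹)²+(S²)²) + ω(S³) = ω(S⁺_tot S⁻_tot)` in the `N`-sector).
[folklore] -/
theorem obsO_eq : obsO Λ = (∑ x : Λ, E x)ᴴ * (∑ x : Λ, E x) + totalSpin 1 2 := by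
  rw [obsO_eq_sum_hop, sum_hop_eq]

/-- `⟨v, O v⟩ = ‖S⁺_tot v‖² + ⟨v, S³_tot v⟩`. [folklore] -/
theorem quad_obsO (v : TensorIndex Λ 2 → ℂ) :
    star v ⬝ᵥ (obsO Λ) *ᵥ v =
      star ((∑ x : Λ, E x) *ᵥ v) ⬝ᵥ ((∑ x : Λ, E x) *ᵥ v) + star v ⬝ᵥ (totalSpin 1 2) *ᵥ v := by
  rw [obsO_eq, add_mulVec, dotProduct_add, star_dotProduct_conjTranspose_mul_mulVec]

/-- `S⁺_tot |⇑⟩ = 0`. [folklore] -/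
theorem sumE_mulVec_upVec : (∑ x : Λ, E x) *ᵥ (upVec : TensorIndex Λ 2 → ℂ) = 0 := by
  rw [Matrix.sum_mulVec]
  exact Finset.sum_eq_zero fun x _ => E_mulVec_upVec x

/-- `S³_tot |⇑⟩ = (|Λ|/2) |⇑⟩`. [folklore] -/
theorem totalSpin_two_mulVec_upVec :
    (totalSpin 1 2 : Op Λ 2) *ᵥ upVec = ((Fintype.card Λ : ℂ) / 2) • (upVec : TensorIndex Λ 2 → ℂ) := by
  have h := totalSpin_two_mulVec_single (Λ := Λ) (fun _ => (0 : Fin 2))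
  rw [(downCount_eq_zero_iff _).mpr rfl, Nat.cast_zero, sub_zero] at h
  exact h

/-- On the ray of `|⇑⟩` the order parameter is exactly `|Λ|/2` per unit norm:
`Re⟨a⇑, O a⇑⟩ = (|Λ|/2)‖a⇑‖²`. [folklore] -/
theorem re_quad_obsO_smul_upVec (a : ℂ) :
    (star (a • (upVec : TensorIndex Λ 2 → ℂ)) ⬝ᵥ (obsO Λ) *ᵥ (a • upVec)).re =
      (Fintype.card Λ : ℝ) / 2 * (star (a • (upVec : TensorIndex Λ 2 → ℂ)) ⬝ᵥ (a • upVec)).re := by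
  rw [quad_obsO, mulVec_smul, sumE_mulVec_upVec, smul_zero, dotProduct_zero, zero_add, mulVec_smul,
    totalSpin_two_mulVec_upVec, smul_comm, dotProduct_smul, smul_eq_mul]
  have : ((Fintype.card Λ : ℂ) / 2) = (((Fintype.card Λ : ℝ) / 2 : ℝ) : ℂ) := by push_cast; ring
  rw [this, Complex.re_ofReal_mul]

variable (L : ℕ) [NeZero L]

/-- `pen |⇑⟩ = (L³ − N) |⇑⟩`. [folklore] -/
theorem pen_mulVec_upVec (N : ℕ) :
    pen L N *ᵥ upVec = ((L : ℂ) ^ 3 - N) • (upVec : TensorIndex (TorusSite 3 L) 2 → ℂ) := by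
  ext σ
  rw [pen_mulVec_apply, Pi.smul_apply, smul_eq_mul]
  by_cases hσ : σ = fun _ => 0
  · subst hσ
    rw [(downCount_eq_zero_iff _).mpr rfl, Nat.cast_zero, sub_zero]
  · have h0 : (upVec : TensorIndex (TorusSite 3 L) 2 → ℂ) σ = 0 := by
      rw [upVec, Pi.single_apply, if_neg hσ]
    rw [h0, mul_zero, mul_zero]

/-- `H_pen(L,N) |⇑⟩ = 4L³(L³ − N)² |⇑⟩`: the all-up vector is always an eigenvector. [folklore] -/
theorem Hpen_mulVec_upVec (hL : 3 ≤ L) (N : ℕ) :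
    Hpen L N *ᵥ upVec = ((((3 + 1) * L ^ 3 : ℕ) : ℂ) * ((L : ℂ) ^ 3 - N) ^ 2) • upVec := by
  rw [Hpen_eq, add_mulVec, xyTorus_eq_Hmu_zero, hmu_mulVec_upVec L hL 0, smul_mulVec, pow_two,
    ← mulVec_mulVec, pen_mulVec_upVec, mulVec_smul, pen_mulVec_upVec, smul_smul, smul_smul]
  have : ((-(0 * (Fintype.card (TorusSite 3 L) : ℝ) / 2) : ℝ) : ℂ) = 0 := by push_cast; ring
  rw [this, zero_smul, zero_add, pow_two, mul_assoc]

/-- Variational bound `E₀(H_pen(L,N)) ≤ 4L³(L³ − N)²` (trial state `|⇑⟩`). [folklore] -/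
theorem groundEnergy_Hpen_le (hL : 3 ≤ L) (N : ℕ) :
    (Hpen L N).groundEnergy ≤ 4 * (L : ℝ) ^ 3 * ((L : ℝ) ^ 3 - N) ^ 2 := by
  have h := groundEnergy_le_rayleigh_holds (Hpen_isHermitian L N) upVec star_upVec_dotProduct_upVec
  rw [Hpen_mulVec_upVec L hL N, dotProduct_smul, star_upVec_dotProduct_upVec, smul_eq_mul,
    mul_one] at h
  have hc : ((((3 + 1) * L ^ 3 : ℕ) : ℂ) * ((L : ℂ) ^ 3 - N) ^ 2) =
      ((4 * (L : ℝ) ^ 3 * ((L : ℝ) ^ 3 - N) ^ 2 : ℝ) : ℂ) := by push_cast; ring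
  rwa [hc, Complex.ofReal_re] at h

/-- **At full filling the ground space is the all-up ray.** For `N = L³` every ground vector of
`H_pen(L,L³)` is a multiple of `|⇑⟩` (from (★): `Σ_σ #↓σ ‖v σ‖² ≤ Re⟨v,H_pen v⟩ = E₀‖v‖² ≤ 0`).
[folklore] -/
theorem eq_smul_upVec_of_mem_groundSpace_full (hL : 3 ≤ L)
    {v : TensorIndex (TorusSite 3 L) 2 → ℂ} (hv : v ∈ (Hpen L (L ^ 3)).groundSpace) :
    v = v (fun _ => 0) • upVec := by
  have hE := groundEnergy_Hpen_le L hL (L ^ 3)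
  have hE0 : (Hpen L (L ^ 3)).groundEnergy ≤ 0 := by
    have : ((L : ℝ) ^ 3 - ((L ^ 3 : ℕ) : ℝ)) = 0 := by push_cast; ring
    rw [this] at hE
    simpa using hE
  rw [mem_groundSpace_iff] at hv
  have hvv : 0 ≤ (star v ⬝ᵥ v).re := (Complex.nonneg_iff.mp (dotProduct_star_self_nonneg _)).1
  have hquad : (star v ⬝ᵥ (Hpen L (L ^ 3)) *ᵥ v).re ≤ 0 := by
    rw [hv, dotProduct_smul, smul_eq_mul, Complex.re_ofReal_mul]
    exact mul_nonpos_of_nonpos_of_nonneg hE0 hvv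
  have hM := re_quad_Hpen_ge L hL (L ^ 3) v
  have hL1 : (1 : ℝ) ≤ (L : ℝ) ^ 3 :=
    one_le_pow₀ (by exact_mod_cast (le_trans (by norm_num : 1 ≤ 3) hL))
  have hterm : ∀ σ : TensorIndex (TorusSite 3 L) 2, (downCount σ : ℝ) * ‖v σ‖ ^ 2 ≤
      (4 * (L : ℝ) ^ 3 * ((L : ℝ) ^ 3 - ((L ^ 3 : ℕ) : ℝ) - downCount σ) ^ 2 - 3 * downCount σ) *
        ‖v σ‖ ^ 2 := by
    intro σ
    have hn : 0 ≤ ‖v σ‖ ^ 2 := sq_nonneg _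
    apply mul_le_mul_of_nonneg_right _ hn
    have hcast : ((L : ℝ) ^ 3 - ((L ^ 3 : ℕ) : ℝ) - downCount σ) ^ 2 = (downCount σ : ℝ) ^ 2 := by
      push_cast; ring
    rw [hcast]
    rcases Nat.eq_zero_or_pos (downCount σ) with h0 | hpos
    · rw [h0]; simp
    · have hk : (1 : ℝ) ≤ downCount σ := by exact_mod_cast hpos
      nlinarith
  have hsum : ∑ σ, (downCount σ : ℝ) * ‖v σ‖ ^ 2 ≤ 0 :=
    (Finset.sum_le_sum fun σ _ => hterm σ).trans (hM.trans hquad)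
  have hnn : ∀ σ ∈ (Finset.univ : Finset (TensorIndex (TorusSite 3 L) 2)),
      0 ≤ (downCount σ : ℝ) * ‖v σ‖ ^ 2 := fun σ _ =>
    mul_nonneg (Nat.cast_nonneg _) (sq_nonneg _)
  have hzero := (Finset.sum_eq_zero_iff_of_nonneg hnn).mp (le_antisymm hsum (Finset.sum_nonneg hnn))
  funext τ
  by_cases hτ : τ = fun _ => 0
  · subst hτ
    simp [upVec]
  · have hk : downCount τ ≠ 0 := fun h => hτ ((downCount_eq_zero_iff τ).mp h)
    have hkpos : (0 : ℝ) < downCount τ := by exact_mod_cast Nat.pos_of_ne_zero hk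
    have h := hzero τ (Finset.mem_univ τ)
    have hn : ‖v τ‖ ^ 2 = 0 := by
      rcases mul_eq_zero.mp h with h | h
      · exact absurd h hkpos.ne'
      · exact h
    have hv0 : v τ = 0 := by
      have : ‖v τ‖ = 0 := by
        have := sq_eq_zero_iff.mp hn
        exact this
      exact norm_eq_zero.mp this
    rw [hv0, Pi.smul_apply, upVec, Pi.single_apply, if_neg hτ, smul_zero]

/-- **`Re ω(O) ≤ L³/2` at full filling** (positivity transfer of `(L³/2)·1 − O ≥ 0` on the ground
space, where it vanishes identically). [folklore] -/
theorem re_gsf_obsO_full_le (hL : 3 ≤ L) :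
    ((Hpen L (L ^ 3)).groundStateFunctional (obsO (TorusSite 3 L))).re ≤ (L : ℝ) ^ 3 / 2 := by
  have hT : ∀ v ∈ (Hpen L (L ^ 3)).groundSpace,
      0 ≤ (star v ⬝ᵥ ((((L : ℝ) ^ 3 / 2 : ℝ) : ℂ) • (1 : Op (TorusSite 3 L) 2) -
        obsO (TorusSite 3 L)) *ᵥ v).re := by
    intro v hv
    obtain ⟨a, rfl⟩ : ∃ a : ℂ, v = a • upVec :=
      ⟨v (fun _ => 0), eq_smul_upVec_of_mem_groundSpace_full L hL hv⟩
    rw [sub_mulVec, dotProduct_sub, Complex.sub_re, smul_mulVec, one_mulVec, dotProduct_smul,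
      smul_eq_mul, Complex.re_ofReal_mul, re_quad_obsO_smul_upVec, card_site]
    push_cast
    linarith
  have h := re_gsf_nonneg_of_groundSpace hT
  rw [map_sub, map_smul, groundStateFunctional_one (Hpen_isHermitian L _), Complex.sub_re,
    smul_eq_mul, mul_one, Complex.ofReal_re] at h
  linarith

/-- **`rhs(L, L³) ≤ L³`**: at full filling the order parameter is `⟨S⁺_totS⁻_tot⟩ ≤ L³ = N`
(`N₀ ≤ 1`). [folklore] -/
theorem rhs_full_le (hL : 3 ≤ L) : rhs L (L ^ 3) ≤ (L : ℝ) ^ 3 := by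
  have h := re_gsf_obsO_full_le L hL
  rw [rhs]
  push_cast
  linarith

end FullFilling

/-- The crux with the half-filling restriction `2 * N ≤ L ^ 3` relaxed to `N ≤ L ^ 3`
("uniform BEC at EVERY filling"); everything else verbatim. -/
def KineticLatticeBECWithoutHalfFilling : Prop :=
  ∃ c : ℝ, 0 < c ∧ ∃ L₀ : ℕ, ∀ (L : ℕ) [NeZero L], L₀ ≤ L → Even L → ∀ N : ℕ, 1 ≤ N → N ≤ L ^ 3 →
    c * N * (L : ℝ) ^ 3 ≤ rhs L N

/-- **(a) The filling restriction is load-bearing**: uniform BEC at every filling `N ≤ L³` is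
FALSE — witness `N = L³` on any even torus with `c L³ > 1` (`rhs_full_le`). Any proof of the crux
must use `2N ≤ L³` (or at least `N ≤ (1 − δ)L³`). [folklore] -/
theorem kineticLatticeBEC_false_without_halfFilling : ¬ KineticLatticeBECWithoutHalfFilling := by
  rintro ⟨c, hc, L₀, h⟩
  obtain ⟨m, hm⟩ := exists_nat_gt (1 / c)
  have hL0 : (2 * (L₀ + m + 2)) ≠ 0 := by omega
  haveI : NeZero (2 * (L₀ + m + 2)) := ⟨hL0⟩
  have hL3 : 3 ≤ 2 * (L₀ + m + 2) := by omega
  have hN1 : 1 ≤ (2 * (L₀ + m + 2)) ^ 3 := Nat.one_le_pow _ _ (by omega)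
  have key := h (2 * (L₀ + m + 2)) (by omega) ⟨L₀ + m + 2, by ring⟩ ((2 * (L₀ + m + 2)) ^ 3) hN1 le_rfl
  have hr := rhs_full_le (2 * (L₀ + m + 2)) hL3
  set x : ℝ := ((2 * (L₀ + m + 2) : ℕ) : ℝ) with hx
  have hxm : (m : ℝ) + 1 ≤ x := by
    rw [hx]; push_cast; linarith
  have hx1 : (1 : ℝ) ≤ x := by
    have : (0 : ℝ) ≤ m := Nat.cast_nonneg _
    linarith
  have hcm : 1 < c * m := by
    rw [div_lt_iff₀ hc] at hm
    linarith
  rw [Nat.cast_pow] at key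
  rw [← hx] at key
  -- key : c * x^3 * x^3 ≤ rhs;  hr : rhs ≤ x^3
  have hx3 : (0 : ℝ) < x ^ 3 := by positivity
  have h1 : c * x ^ 3 ≤ 1 := by
    by_contra hcon
    push Not at hcon
    have : x ^ 3 < c * x ^ 3 * x ^ 3 := by nlinarith
    linarith
  have h2 : x ≤ x ^ 3 := le_self_pow₀ hx1 (by norm_num)
  nlinarith [mul_le_mul_of_nonneg_left h2 hc.le, mul_le_mul_of_nonneg_left hxm hc.le]


/-! ### §3 (b) TIGHTNESS of the constant: `c ≤ ½` (the Casimir / Tóth ceiling at half filling)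

For EVERY vector `v` (no ground-state or sector input):
`Re⟨v, ((S¹_tot)²+(S²_tot)²) v⟩ ≤ (|Λ|²/4 + |Λ|/2)‖v‖²` — the spin-½ Casimir ceiling
`(S¹)²+(S²)² ≤ 𝐒² ≤ S_max(S_max+1)`, `S_max = |Λ|/2`, proved here by Cauchy–Schwarz and double
counting in the configuration basis (`‖S⁺_tot v‖² ≤ Σ_τ #↓τ(|Λ| − #↓τ + 1)|v_τ|²`, Tóth's
combinatorics). At half filling `N = L³/2` the crux demands `c·L⁶/2 ≤ Re ω(O) ≤ L⁶/4 + L³/2`, so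
ANY admissible constant has `c ≤ ½` (`constant_le_half`); spin-wave / QMC estimates for the 3-D
quantum XY model give `N₀/N = 2m² ≈ 0.4` there (`m ≈ 0.45` of `½`), so the ceiling is nearly attained
and the crux is only plausible with `c < ½`; exact diagonalisation (job j013112) gives `N₀/N = 0.594`
on the `2³` torus at half filling (Tóth ceiling `0.625`).
Combined with the sibling disprover's `four_le_const` (crux K1 forces `M ≥ 4`), the route's own
constant is `c = 1/max(M,1) ≤ ¼`. -/

section Casimir

variable {Λ : Type*} [Fintype Λ] [DecidableEq Λ]

/-- `Re⟨w, w⟩ = Σ_i ‖w_i‖²`. [folklore] -/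
theorem re_star_dotProduct_self {m : Type*} [Fintype m] (w : m → ℂ) :
    (star w ⬝ᵥ w).re = ∑ i, ‖w i‖ ^ 2 := by
  rw [dotProduct, Complex.re_sum]
  refine Finset.sum_congr rfl fun i _ => ?_
  rw [Pi.star_apply, Complex.star_def, Complex.conj_mul']
  norm_cast

/-- `Re⟨v, S³_tot v⟩ = Σ_σ (|Λ|/2 − #↓σ)‖v σ‖²`. [folklore] -/
theorem re_quad_totalSpin_two (v : TensorIndex Λ 2 → ℂ) :
    (star v ⬝ᵥ (totalSpin 1 2 : Op Λ 2) *ᵥ v).re =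
      ∑ σ, ((Fintype.card Λ : ℝ) / 2 - downCount σ) * ‖v σ‖ ^ 2 := by
  rw [totalSpin_two_eq, sub_mulVec, smul_mulVec, one_mulVec, dotProduct_sub, dotProduct_smul,
    smul_eq_mul, quad_sumPd, Complex.sub_re, Complex.ofReal_re]
  have : ((Fintype.card Λ : ℂ) / 2) = (((Fintype.card Λ : ℝ) / 2 : ℝ) : ℂ) := by push_cast; ring
  rw [this, Complex.re_ofReal_mul, re_star_dotProduct_self, Finset.mul_sum, ← Finset.sum_sub_distrib]
  refine Finset.sum_congr rfl fun σ _ => ?_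
  ring

/-- `(S⁺_tot v)(σ) = Σ_{x : σ_x = ↑} v(σ with x ↓)`. [folklore] -/
theorem sumE_mulVec_apply (v : TensorIndex Λ 2 → ℂ) (σ : TensorIndex Λ 2) :
    ((∑ x : Λ, E x) *ᵥ v) σ = ∑ x, if σ x = 0 then v (Function.update σ x 1) else 0 := by
  rw [Matrix.sum_mulVec, Finset.sum_apply]
  exact Finset.sum_congr rfl fun x _ => E_mulVec_apply x v σ

/-- Flipping the spin at `x`: an involution of configuration space. [folklore] -/
def flipAt (x : Λ) (σ : TensorIndex Λ 2) : TensorIndex Λ 2 := Function.update σ x (σ x).rev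

omit [Fintype Λ] in
/-- Flipping twice is the identity. [folklore] -/
theorem flipAt_involutive (x : Λ) : Function.Involutive (flipAt (Λ := Λ) x) := by
  intro σ
  simp only [flipAt, Function.update_self, Fin.rev_rev, Function.update_idem, Function.update_eq_self]

/-- **Double counting** `(σ, x with σ_x = ↑) ↔ (τ, x with τ_x = ↓)`, `τ = σ^{x↓}`. [folklore] -/
theorem sum_flip (x : Λ) (g : TensorIndex Λ 2 → ℝ) :
    ∑ σ : TensorIndex Λ 2, (if σ x = 0 then g (Function.update σ x 1) else 0) =
      ∑ τ : TensorIndex Λ 2, (if τ x = 1 then g τ else 0) := by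
  rw [← Equiv.sum_comp (flipAt_involutive x).toPerm (fun τ => if τ x = 1 then g τ else 0)]
  refine Finset.sum_congr rfl fun σ _ => ?_
  simp only [Function.Involutive.coe_toPerm, flipAt, Function.update_self]
  have hr0 : (0 : Fin 2).rev = 1 := rfl
  have hr1 : (1 : Fin 2).rev = 0 := rfl
  rcases Fin.exists_fin_two.mp ⟨σ x, rfl⟩ with h | h
  · rw [if_pos h, h, hr0, if_pos rfl]
  · rw [if_neg (by rw [h]; decide), h, hr1, if_neg (by decide)]

omit [DecidableEq Λ] in
/-- Lowering one more spin raises the down count by one. [folklore] -/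
theorem downCount_update_one [DecidableEq Λ] {σ : TensorIndex Λ 2} {x : Λ} (h : σ x = 0) :
    downCount (Function.update σ x 1) = downCount σ + 1 := by
  unfold downCount
  have hs : (Finset.univ.filter fun y : Λ => Function.update σ x 1 y = 1) =
      insert x (Finset.univ.filter fun y : Λ => σ y = 1) := by
    ext y
    by_cases hy : y = x
    · subst hy
      simp
    · simp [hy]
  rw [hs, Finset.card_insert_of_notMem]
  simp [h]

omit [DecidableEq Λ] in
/-- `#↑σ = |Λ| − #↓σ`. [folklore] -/
theorem card_filter_up (σ : TensorIndex Λ 2) :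
    ((Finset.univ.filter fun x : Λ => σ x = 0).card : ℝ) = Fintype.card Λ - downCount σ := by
  have h := Finset.card_filter_add_card_filter_not (s := (Finset.univ : Finset Λ))
    (fun x : Λ => σ x = 0)
  have h2 : (Finset.univ.filter fun x : Λ => ¬ σ x = 0) = Finset.univ.filter fun x : Λ => σ x = 1 := by
    ext y
    simp only [Finset.mem_filter, Finset.mem_univ, true_and]
    rcases Fin.exists_fin_two.mp ⟨σ y, rfl⟩ with hy | hy <;> simp [hy]
  rw [h2, Finset.card_univ] at h
  rw [downCount]
  have := congrArg (Nat.cast (R := ℝ)) h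
  push_cast at this
  linarith

/-- **Cauchy–Schwarz per configuration**: `|(S⁺_tot v)(σ)|² ≤ #↑σ · Σ_{x:σ_x=↑} |v(σ^{x↓})|²`.
[folklore] -/
theorem normSq_sumE_mulVec_le (v : TensorIndex Λ 2 → ℂ) (σ : TensorIndex Λ 2) :
    ‖((∑ x : Λ, E x) *ᵥ v) σ‖ ^ 2 ≤ ((Fintype.card Λ : ℝ) - downCount σ) *
      ∑ x, (if σ x = 0 then ‖v (Function.update σ x 1)‖ ^ 2 else 0) := by
  rw [sumE_mulVec_apply, ← Finset.sum_filter, ← Finset.sum_filter, ← card_filter_up]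
  set s := Finset.univ.filter fun x : Λ => σ x = 0
  calc ‖∑ x ∈ s, v (Function.update σ x 1)‖ ^ 2
      ≤ (∑ x ∈ s, ‖v (Function.update σ x 1)‖) ^ 2 := by
        gcongr
        exact norm_sum_le _ _
    _ ≤ s.card * ∑ x ∈ s, ‖v (Function.update σ x 1)‖ ^ 2 := sq_sum_le_card_mul_sum_sq

/-- **Tóth's combinatorial Casimir bound**: `‖S⁺_tot v‖² ≤ Σ_τ #↓τ (|Λ| − #↓τ + 1) |v_τ|²`
(equality of the coefficient with `S_max(S_max+1) − M(M+1)` in the sector `M = |Λ|/2 − #↓`).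
[folklore] -/
theorem normSq_sumE_mulVec_sum_le (v : TensorIndex Λ 2 → ℂ) :
    ∑ σ, ‖((∑ x : Λ, E x) *ᵥ v) σ‖ ^ 2 ≤
      ∑ τ, (downCount τ : ℝ) * (Fintype.card Λ - downCount τ + 1) * ‖v τ‖ ^ 2 := by
  set V : ℝ := (Fintype.card Λ : ℝ) with hV
  calc ∑ σ, ‖((∑ x : Λ, E x) *ᵥ v) σ‖ ^ 2
      ≤ ∑ σ : TensorIndex Λ 2, (V - downCount σ) *
          ∑ x, (if σ x = 0 then ‖v (Function.update σ x 1)‖ ^ 2 else 0) :=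
        Finset.sum_le_sum fun σ _ => normSq_sumE_mulVec_le v σ
    _ = ∑ σ : TensorIndex Λ 2, ∑ x : Λ, (if σ x = 0 then
          (V - downCount (Function.update σ x 1) + 1) * ‖v (Function.update σ x 1)‖ ^ 2 else 0) := by
        refine Finset.sum_congr rfl fun σ _ => ?_
        rw [Finset.mul_sum]
        refine Finset.sum_congr rfl fun x _ => ?_
        split_ifs with h
        · rw [downCount_update_one h]
          push_cast
          ring
        · rw [mul_zero]
    _ = ∑ x : Λ, ∑ τ : TensorIndex Λ 2, (if τ x = 1 then (V - downCount τ + 1) * ‖v τ‖ ^ 2 else 0) := by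
        rw [Finset.sum_comm]
        exact Finset.sum_congr rfl fun x _ => sum_flip x (fun τ => (V - downCount τ + 1) * ‖v τ‖ ^ 2)
    _ = ∑ τ : TensorIndex Λ 2, (downCount τ : ℝ) * (V - downCount τ + 1) * ‖v τ‖ ^ 2 := by
        rw [Finset.sum_comm]
        refine Finset.sum_congr rfl fun τ _ => ?_
        rw [Finset.sum_ite, Finset.sum_const_zero, add_zero, Finset.sum_const, nsmul_eq_mul, downCount]
        ring

/-- **The Casimir ceiling for the crux observable**, for every vector:
`Re⟨v, ((S¹_tot)²+(S²_tot)²) v⟩ ≤ (|Λ|²/4 + |Λ|/2)‖v‖²`. [folklore] -/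
theorem re_quad_obsO_le (v : TensorIndex Λ 2 → ℂ) :
    (star v ⬝ᵥ (obsO Λ) *ᵥ v).re ≤
      ((Fintype.card Λ : ℝ) ^ 2 / 4 + Fintype.card Λ / 2) * (star v ⬝ᵥ v).re := by
  set V : ℝ := (Fintype.card Λ : ℝ) with hV
  rw [quad_obsO, Complex.add_re, re_star_dotProduct_self, re_quad_totalSpin_two,
    re_star_dotProduct_self]
  have hB := normSq_sumE_mulVec_sum_le v
  calc (∑ σ, ‖((∑ x : Λ, E x) *ᵥ v) σ‖ ^ 2) + ∑ σ, (V / 2 - downCount σ) * ‖v σ‖ ^ 2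
      ≤ ∑ τ, (downCount τ : ℝ) * (V - downCount τ + 1) * ‖v τ‖ ^ 2 +
          ∑ σ, (V / 2 - downCount σ) * ‖v σ‖ ^ 2 := by linarith
    _ = ∑ τ, ((downCount τ : ℝ) * (V - downCount τ) + V / 2) * ‖v τ‖ ^ 2 := by
        rw [← Finset.sum_add_distrib]
        refine Finset.sum_congr rfl fun τ _ => ?_
        ring
    _ ≤ ∑ τ, (V ^ 2 / 4 + V / 2) * ‖v τ‖ ^ 2 := by
        refine Finset.sum_le_sum fun τ _ => ?_
        apply mul_le_mul_of_nonneg_right _ (sq_nonneg _)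
        nlinarith [sq_nonneg (V - 2 * downCount τ)]
    _ = (V ^ 2 / 4 + V / 2) * ∑ τ, ‖v τ‖ ^ 2 := by rw [Finset.mul_sum]

variable (L : ℕ) [NeZero L]

/-- `Re ω(O) ≤ L⁶/4 + L³/2` for the tracial ground state of EVERY `H_pen(L,N)`. [folklore] -/
theorem re_gsf_obsO_le (N : ℕ) :
    ((Hpen L N).groundStateFunctional (obsO (TorusSite 3 L))).re ≤ (L : ℝ) ^ 6 / 4 + (L : ℝ) ^ 3 / 2 := by
  have hT : ∀ v ∈ (Hpen L N).groundSpace,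
      0 ≤ (star v ⬝ᵥ ((((L : ℝ) ^ 6 / 4 + (L : ℝ) ^ 3 / 2 : ℝ) : ℂ) • (1 : Op (TorusSite 3 L) 2) -
        obsO (TorusSite 3 L)) *ᵥ v).re := by
    intro v _
    have h := re_quad_obsO_le v
    rw [card_site] at h
    push_cast at h
    rw [sub_mulVec, dotProduct_sub, Complex.sub_re, smul_mulVec, one_mulVec, dotProduct_smul,
      smul_eq_mul, Complex.re_ofReal_mul]
    have h6 : ((L : ℝ) ^ 3) ^ 2 / 4 = (L : ℝ) ^ 6 / 4 := by ring
    rw [h6] at h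
    linarith
  have h := re_gsf_nonneg_of_groundSpace hT
  rw [map_sub, map_smul, groundStateFunctional_one (Hpen_isHermitian L _), Complex.sub_re,
    smul_eq_mul, mul_one, Complex.ofReal_re] at h
  linarith

/-- **Ceiling for the crux's right-hand side**: `rhs(L,N) ≤ L⁶/4 + N` at every `N`. [folklore] -/
theorem rhs_le (N : ℕ) : rhs L N ≤ (L : ℝ) ^ 6 / 4 + N := by
  rw [rhs]
  have := re_gsf_obsO_le L N
  linarith

end Casimir

/-- **(b) TIGHTNESS: any admissible constant is at most `½`.** At half filling `N = L³/2` the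
crux reads `c L⁶/2 ≤ Re ω(O) ≤ L⁶/4 + L³/2`. (Spin waves / QMC: `N₀/N ≈ 0.4` there.) [folklore] -/
theorem constant_le_half {c : ℝ} {L₀ : ℕ} (h : KineticLatticeBECWith c L₀) : c ≤ 1 / 2 := by
  by_contra hcon
  push Not at hcon
  have hd : 0 < c - 1 / 2 := by linarith
  obtain ⟨m, hm⟩ := exists_nat_gt (1 / (c - 1 / 2))
  set n : ℕ := L₀ + m + 1 with hn
  have hn1 : 1 ≤ n := by omega
  have hL0 : 2 * n ≠ 0 := by omega
  haveI : NeZero (2 * n) := ⟨hL0⟩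
  have hN1 : 1 ≤ 4 * n ^ 3 := by
    have := Nat.one_le_pow 3 n hn1
    omega
  have hN2 : 2 * (4 * n ^ 3) ≤ (2 * n) ^ 3 := le_of_eq (by ring)
  have key := h (2 * n) (by omega) ⟨n, two_mul n⟩ (4 * n ^ 3) hN1 hN2
  have hr := rhs_le (2 * n) (4 * n ^ 3)
  push_cast at key hr
  have hy1 : (1 : ℝ) ≤ n := by exact_mod_cast hn1
  have hym : (m : ℝ) ≤ n := by rw [hn]; push_cast; linarith
  have hcm : 1 < (c - 1 / 2) * m := by
    rw [div_lt_iff₀ hd] at hm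
    linarith
  have hcy : 1 < (c - 1 / 2) * n := lt_of_lt_of_le hcm (by nlinarith)
  -- key + hr : c * (4 n³) (2n)³ ≤ (2n)⁶/4 + 4n³, i.e. 32 c n⁶ ≤ 16 n⁶ + 4 n³
  have hy3 : (1 : ℝ) ≤ (n : ℝ) ^ 3 := one_le_pow₀ hy1
  have h1 : (c - 1 / 2) * 8 * (n : ℝ) ^ 3 ≤ 1 := by
    have hpos : (0 : ℝ) < 4 * (n : ℝ) ^ 3 := by positivity
    have hmain : c * (4 * (n : ℝ) ^ 3) * (2 * n) ^ 3 ≤ (2 * (n : ℝ)) ^ 6 / 4 + 4 * n ^ 3 :=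
      key.trans hr
    have : (4 * (n : ℝ) ^ 3) * ((c - 1 / 2) * 8 * (n : ℝ) ^ 3) ≤ (4 * (n : ℝ) ^ 3) * 1 := by
      nlinarith
    exact le_of_mul_le_mul_left this hpos
  have h2 : (n : ℝ) ≤ (n : ℝ) ^ 3 := le_self_pow₀ hy1 (by norm_num)
  nlinarith [mul_le_mul_of_nonneg_left h2 hd.le]

/-- **(c) A refuted strengthening: no constant above `½`**, in particular the "no depletion"
version `c = 1` of the crux is FALSE (interaction depletes the condensate; at half filling by at
least a factor two). [folklore] -/
theorem not_kineticLatticeBECWith_of_half_lt {c : ℝ} (hc : 1 / 2 < c) (L₀ : ℕ) :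
    ¬ KineticLatticeBECWith c L₀ := fun h =>
  absurd (constant_le_half h) (not_le.mpr hc)

/-- The `c = 1` instance ("`N₀ ≥ N`", zero depletion) is refuted at every `L₀`. [folklore] -/
theorem not_kineticLatticeBECWith_one (L₀ : ℕ) : ¬ KineticLatticeBECWith 1 L₀ :=
  not_kineticLatticeBECWith_of_half_lt (by norm_num) L₀

/-! ### §4 PARTICLE–HOLE SYMMETRY: `rhs(L,N) = rhs(L,L³−N) + 2N − L³`, and the cap `½` is immaterial

The global spin flip `U = ⨂σˣ` (bosonic particle–hole map) fixes `O = (S¹)²+(S²)²` and maps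
`H_pen(L,N)` to `H_pen(L,L³−N)`; covariance of the tracial ground state gives the exact identity
`rhs_particle_hole`. Consequences: the zero-mode occupations satisfy `N₀(N) = N₀(L³−N) + (2N−L³)/L³`,
so (i) uniform BEC up to ANY fixed-fraction cap `N ≤ (1−δ)L³`, `0 < δ ≤ ½`, is EQUIVALENT to the crux
(`kineticLatticeBEC_iff_cap`: the RP-born `½` carries no information), while (ii) every cap of the form
`N ≤ L³ − K` with `K` FIXED is refuted in §2/§5 — the filling hypothesis is load-bearing exactly at
linear order in `L³`. -/

section ParticleHole

variable {Λ : Type*} [Fintype Λ] [DecidableEq Λ]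

/-- The crux observable is particle–hole invariant: `U O Uᴴ = O`. [folklore] -/
theorem flip_conj_obsO : flipOp * obsO Λ * flipOpᴴ = obsO Λ := by
  rw [obsO_eq_sum_hop, Finset.mul_sum, Finset.sum_mul]
  refine Finset.sum_congr rfl fun x _ => ?_
  rw [Finset.mul_sum, Finset.sum_mul]
  exact Finset.sum_congr rfl fun y _ => flip_conj_hop x y

variable (L : ℕ) [NeZero L]

/-- `U pen(L,N) Uᴴ = −pen(L,L³−N)` for `N ≤ L³`. [folklore] -/
theorem flip_conj_pen {N : ℕ} (hN : N ≤ L ^ 3) :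
    flipOp * pen L N * flipOpᴴ = -pen L (L ^ 3 - N) := by
  rw [pen, pen, Matrix.mul_add, Matrix.add_mul, flip_conj_totalSpin_two, Matrix.mul_smul,
    Matrix.smul_mul, Matrix.mul_one, flipOp_mul_conjTranspose, Nat.cast_sub hN, Nat.cast_pow,
    neg_add, ← neg_smul]
  congr 1
  ring

/-- **`U H_pen(L,N) Uᴴ = H_pen(L,L³−N)`** (`L ≥ 3`, `N ≤ L³`). [folklore] -/
theorem flip_conj_Hpen (hL : 3 ≤ L) {N : ℕ} (hN : N ≤ L ^ 3) :
    flipOp * Hpen L N * flipOpᴴ = Hpen L (L ^ 3 - N) := by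
  have hsq : flipOp * (pen L N * pen L N) * flipOpᴴ =
      (flipOp * pen L N * flipOpᴴ) * (flipOp * pen L N * flipOpᴴ) := by
    rw [Matrix.mul_assoc (flipOp * pen L N) flipOpᴴ (flipOp * pen L N * flipOpᴴ),
      ← Matrix.mul_assoc flipOpᴴ (flipOp * pen L N) flipOpᴴ,
      ← Matrix.mul_assoc flipOpᴴ flipOp (pen L N), flipOp_conjTranspose_mul, Matrix.one_mul,
      Matrix.mul_assoc, Matrix.mul_assoc, Matrix.mul_assoc]
  rw [Hpen_eq, Hpen_eq, Matrix.mul_add, Matrix.add_mul, xyTorus_eq_Hmu_zero, flip_conj_hmu L hL 0,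
    neg_zero, Matrix.mul_smul, Matrix.smul_mul, pow_two, pow_two, hsq, flip_conj_pen L hN,
    neg_mul_neg]

/-- The tracial ground-state expectation of `O` is particle–hole symmetric. [folklore] -/
theorem gsf_obsO_particle_hole (hL : 3 ≤ L) {N : ℕ} (hN : N ≤ L ^ 3) :
    (Hpen L (L ^ 3 - N)).groundStateFunctional (obsO (TorusSite 3 L)) =
      (Hpen L N).groundStateFunctional (obsO (TorusSite 3 L)) := by
  have h := groundStateFunctional_unitary_conj (A := Hpen L N) flipOp_mul_conjTranspose
    flipOp_conjTranspose_mul (obsO (TorusSite 3 L))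
  rwa [flip_conj_Hpen L hL hN, flip_conj_obsO] at h

/-- **PARTICLE–HOLE IDENTITY** `rhs(L,N) = rhs(L,L³−N) + 2N − L³` (`L ≥ 3`, `N ≤ L³`); in terms of
zero-mode occupations `N₀(N) = N₀(L³−N) + (2N − L³)/L³`. [folklore] -/
theorem rhs_particle_hole (hL : 3 ≤ L) {N : ℕ} (hN : N ≤ L ^ 3) :
    rhs L N = rhs L (L ^ 3 - N) + 2 * N - (L : ℝ) ^ 3 := by
  rw [rhs, rhs, gsf_obsO_particle_hole L hL hN, Nat.cast_sub hN, Nat.cast_pow]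
  ring

end ParticleHole

/-- The crux with the half-filling cap replaced by a fixed-fraction cap `N ≤ (1 − δ)L³`. -/
def KineticLatticeBECCap (δ : ℝ) : Prop :=
  ∃ c : ℝ, 0 < c ∧ ∃ L₀ : ℕ, ∀ (L : ℕ) [NeZero L], L₀ ≤ L → Even L → ∀ N : ℕ, 1 ≤ N →
    (N : ℝ) ≤ (1 - δ) * (L : ℝ) ^ 3 → c * N * (L : ℝ) ^ 3 ≤ rhs L N

/-- **The cap `½` is immaterial**: for every `0 < δ ≤ ½`, uniform BEC at all fillings `≤ 1 − δ` is
EQUIVALENT to the crux (fillings `≤ ½`), by the particle–hole identity (constant `c ↦ cδ`).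
[folklore] -/
theorem kineticLatticeBEC_iff_cap {δ : ℝ} (hδ : 0 < δ) (hδ' : δ ≤ 1 / 2) :
    KineticLatticeBEC ↔ KineticLatticeBECCap δ := by
  rw [kineticLatticeBEC_iff]
  constructor
  · rintro ⟨c, hc, L₀, h⟩
    refine ⟨c * δ, mul_pos hc hδ, max L₀ 3, fun L _ hL hE N hN1 hNcap => ?_⟩
    have hL₀ : L₀ ≤ L := le_trans (le_max_left _ _) hL
    have hL3 : 3 ≤ L := le_trans (le_max_right _ _) hL
    have hLpos : (0 : ℝ) < (L : ℝ) ^ 3 := by positivity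
    have hNle : N ≤ L ^ 3 := by
      have : (N : ℝ) ≤ (L : ℝ) ^ 3 := by nlinarith
      exact_mod_cast this
    by_cases h2N : 2 * N ≤ L ^ 3
    · have key := h L hL₀ hE N hN1 h2N
      have : c * δ * N * (L : ℝ) ^ 3 ≤ c * N * (L : ℝ) ^ 3 := by
        have hN0 : (0 : ℝ) ≤ N := Nat.cast_nonneg _
        have : c * δ ≤ c * 1 := by nlinarith
        nlinarith [mul_nonneg hN0 hLpos.le]
      linarith
    · push Not at h2N
      -- the mirror filling N' = L³ − N is at most half and at least δ L³ ≥ 1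
      have hN'1 : 1 ≤ L ^ 3 - N := by
        have : (N : ℝ) < (L : ℝ) ^ 3 := by nlinarith
        have : N < L ^ 3 := by exact_mod_cast this
        omega
      have hN'2 : 2 * (L ^ 3 - N) ≤ L ^ 3 := by omega
      have key := h L hL₀ hE (L ^ 3 - N) hN'1 hN'2
      rw [rhs_particle_hole L hL3 hNle]
      have hcast : ((L ^ 3 - N : ℕ) : ℝ) = (L : ℝ) ^ 3 - N := by
        rw [Nat.cast_sub hNle, Nat.cast_pow]
      rw [hcast] at key
      -- key : c (L³ − N) L³ ≤ rhs L (L³−N); and L³ − N ≥ δ L³, 2N − L³ ≥ 0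
      have h2N' : (L : ℝ) ^ 3 ≤ 2 * N := by exact_mod_cast h2N.le
      have hmirror : δ * (L : ℝ) ^ 3 ≤ (L : ℝ) ^ 3 - N := by nlinarith
      have hNL : (N : ℝ) ≤ (L : ℝ) ^ 3 := by exact_mod_cast hNle
      have h1 : c * δ * N * (L : ℝ) ^ 3 ≤ c * (δ * (L : ℝ) ^ 3) * (L : ℝ) ^ 3 := by
        have : c * δ * N ≤ c * δ * (L : ℝ) ^ 3 := by nlinarith [mul_pos hc hδ]
        nlinarith
      have h2 : c * (δ * (L : ℝ) ^ 3) * (L : ℝ) ^ 3 ≤ c * ((L : ℝ) ^ 3 - N) * (L : ℝ) ^ 3 := by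
        nlinarith [mul_pos hc hLpos]
      linarith
  · rintro ⟨c, hc, L₀, h⟩
    refine ⟨c, hc, L₀, fun L _ hL hE N hN1 h2N => h L hL hE N hN1 ?_⟩
    have : (2 * N : ℝ) ≤ (L : ℝ) ^ 3 := by exact_mod_cast h2N
    nlinarith


/-! ### §5 SECTOR SELECTION (the cheap half of `PenaltySelectsSector`, from (★)), Tóth's ceiling
`rhs(L,N) ≤ N(L³ − N + 1)`, and every FIXED-hole cap `N ≤ L³ − K` is refuted

`H_pen(L,N)` is block diagonal in the down-spin number (`Hpen_apply_eq_zero_of_downCount_ne`, via the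
landed `xxzZero_apply_eq_zero_of_weight_ne`), its diagonal is `4L³(L³ − N − #↓σ)²`
(`Hpen_apply_self`, so `E₀ ≤ 0` by an in-sector basis vector), and by (★) the off-sector block is
`≥ L³`: hence every ground vector is supported in the sector `n_up = N` (`apply_eq_zero_of_mem_groundSpace`,
`L ≥ 3`, `N ≤ L³`). In the sector the Casimir chain of §3 gives Tóth1991's bound
`rhs_le_toth : rhs(L,N) ≤ N(L³ − N + 1)` (`N₀ ≤ N(L³−N+1)/L³`), and with §4:
`rhs(L, L³ − K) ≤ K(L³−K+1) + L³ − 2K ≤ (K+1)L³`, so `kineticLatticeBEC_false_withHoleCap K` — uniform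
BEC with the cap `N + K ≤ L³` is FALSE for every fixed `K` (`K = 0` is §2). -/

section Sector

open Summit.AtomisticToContinuum.BoseEinsteinCondensation.Theorems.InsertionFieldDelocalisation.Negative
  (xxzZero_apply xxzZero_apply_eq_zero_of_weight_ne)

variable {Λ : Type*} [Fintype Λ] [DecidableEq Λ]

omit [DecidableEq Λ] in
/-- The Lieb–Mattis weight `Σ_x σ_x` of a spin-½ configuration is its down-spin number. [folklore] -/
theorem weight_eq_downCount (σ : TensorIndex Λ 2) : (∑ x, (σ x : ℕ)) = downCount σ := by
  rw [downCount, Finset.card_eq_sum_ones, Finset.sum_filter]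
  refine Finset.sum_congr rfl fun x _ => ?_
  rcases Fin.exists_fin_two.mp ⟨σ x, rfl⟩ with h | h <;> simp [h]

omit [DecidableEq Λ] in
/-- `#↓σ ≤ |Λ|`. [folklore] -/
theorem downCount_le_card (σ : TensorIndex Λ 2) : downCount σ ≤ Fintype.card Λ := by
  rw [downCount]
  exact (Finset.card_filter_le _ _).trans (Finset.card_univ (α := Λ)).le

/-- The Casimir chain of §3, termwise: `Re⟨v, O v⟩ ≤ Σ_τ (#↓τ(|Λ| − #↓τ) + |Λ|/2)|v_τ|²`. [folklore] -/
theorem re_quad_obsO_le_sum (v : TensorIndex Λ 2 → ℂ) :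
    (star v ⬝ᵥ (obsO Λ) *ᵥ v).re ≤
      ∑ τ, ((downCount τ : ℝ) * (Fintype.card Λ - downCount τ) + Fintype.card Λ / 2) * ‖v τ‖ ^ 2 := by
  set V : ℝ := (Fintype.card Λ : ℝ) with hV
  rw [quad_obsO, Complex.add_re, re_star_dotProduct_self, re_quad_totalSpin_two]
  have hB := normSq_sumE_mulVec_sum_le v
  calc (∑ σ, ‖((∑ x : Λ, E x) *ᵥ v) σ‖ ^ 2) + ∑ σ, (V / 2 - downCount σ) * ‖v σ‖ ^ 2
      ≤ ∑ τ, (downCount τ : ℝ) * (V - downCount τ + 1) * ‖v τ‖ ^ 2 +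
          ∑ σ, (V / 2 - downCount σ) * ‖v σ‖ ^ 2 := by linarith
    _ = ∑ τ, ((downCount τ : ℝ) * (V - downCount τ) + V / 2) * ‖v τ‖ ^ 2 := by
        rw [← Finset.sum_add_distrib]
        refine Finset.sum_congr rfl fun τ _ => ?_
        ring

/-- **In-sector Casimir (Tóth) ceiling**: a vector supported on `#↓ = k₀` has
`Re⟨v, O v⟩ ≤ (k₀(|Λ| − k₀) + |Λ|/2)‖v‖²`. [folklore] -/
theorem re_quad_obsO_le_of_support (k₀ : ℕ) (v : TensorIndex Λ 2 → ℂ)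
    (hv : ∀ τ, downCount τ ≠ k₀ → v τ = 0) :
    (star v ⬝ᵥ (obsO Λ) *ᵥ v).re ≤
      ((k₀ : ℝ) * (Fintype.card Λ - k₀) + Fintype.card Λ / 2) * (star v ⬝ᵥ v).re := by
  refine (re_quad_obsO_le_sum v).trans ?_
  rw [re_star_dotProduct_self, Finset.mul_sum]
  refine Finset.sum_le_sum fun τ _ => ?_
  by_cases hτ : downCount τ = k₀
  · rw [hτ]
  · rw [hv τ hτ, norm_zero]
    simp

variable (L : ℕ) [NeZero L]

/-- **`H_pen` is block diagonal in the down-spin number.** [folklore] -/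
theorem Hpen_apply_eq_zero_of_downCount_ne (N : ℕ) {σ τ : TensorIndex (TorusSite 3 L) 2}
    (h : downCount σ ≠ downCount τ) : Hpen L N σ τ = 0 := by
  have hστ : σ ≠ τ := fun hst => h (by rw [hst])
  have h1 : xyTorus 3 L 1 σ τ = 0 :=
    xxzZero_apply_eq_zero_of_weight_ne _ _ (by rwa [weight_eq_downCount, weight_eq_downCount])
  have h2 : (pen L N ^ 2) σ τ = 0 := by
    have := congrFun (mulVec_single_one (pen L N ^ 2) τ) σ
    rw [Matrix.col_apply] at this
    rw [← this, pow_two, ← mulVec_mulVec, pen_mulVec_apply, pen_mulVec_apply, Pi.single_apply,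
      if_neg hστ, mul_zero, mul_zero]
  rw [Hpen_eq, Matrix.add_apply, Matrix.smul_apply, h1, h2, smul_zero, add_zero]

/-- **Diagonal of `H_pen`**: `(H_pen)_{σσ} = 4L³(L³ − N − #↓σ)²` (the XY part has zero diagonal).
[folklore] -/
theorem Hpen_apply_self (N : ℕ) (σ : TensorIndex (TorusSite 3 L) 2) :
    Hpen L N σ σ = (((3 + 1) * L ^ 3 : ℕ) : ℂ) * ((L : ℂ) ^ 3 - N - downCount σ) ^ 2 := by
  have h1 : xyTorus 3 L 1 σ σ = 0 := by
    rw [xyTorus, xxzZero_apply, if_pos rfl]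
  have h2 : (pen L N ^ 2) σ σ = ((L : ℂ) ^ 3 - N - downCount σ) ^ 2 := by
    have := congrFun (mulVec_single_one (pen L N ^ 2) σ) σ
    rw [Matrix.col_apply] at this
    rw [← this, pow_two, ← mulVec_mulVec, pen_mulVec_apply, pen_mulVec_apply, Pi.single_apply,
      if_pos rfl, mul_one, pow_two]
  rw [Hpen_eq, Matrix.add_apply, Matrix.smul_apply, h1, h2, smul_eq_mul, zero_add]

/-- **`E₀(H_pen(L,N)) ≤ 0` for `N ≤ L³`** (trial state: any basis configuration with `N` up spins).
[folklore] -/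
theorem groundEnergy_Hpen_nonpos {N : ℕ} (hN : N ≤ L ^ 3) : (Hpen L N).groundEnergy ≤ 0 := by
  obtain ⟨T, -, hT⟩ := Finset.exists_subset_card_eq (s := (Finset.univ : Finset (TorusSite 3 L)))
    (n := L ^ 3 - N) (by rw [Finset.card_univ, card_site]; omega)
  set ρ : TensorIndex (TorusSite 3 L) 2 := fun x => if x ∈ T then 1 else 0 with hρ
  have hρT : (Finset.univ.filter fun x : TorusSite 3 L => ρ x = 1) = T := by
    ext x
    by_cases hx : x ∈ T <;> simp [hρ, hx]
  have hρd : downCount ρ = L ^ 3 - N := by rw [downCount, hρT, hT]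
  set e : TensorIndex (TorusSite 3 L) 2 → ℂ := Pi.single ρ 1 with he
  have hstar : star e = e := by
    ext τ
    rw [he, Pi.star_apply, Pi.single_apply]
    split_ifs <;> simp
  have hnorm : star e ⬝ᵥ e = 1 := by
    rw [hstar, he, single_dotProduct, one_mul, Pi.single_eq_same]
  have h := groundEnergy_le_rayleigh_holds (Hpen_isHermitian L N) e hnorm
  rw [hstar, he, mulVec_single_one, single_dotProduct, one_mul, Matrix.col_apply, Hpen_apply_self,
    hρd, Nat.cast_sub hN, Nat.cast_pow] at h
  have hz : ((((3 + 1) * L ^ 3 : ℕ) : ℂ) * ((L : ℂ) ^ 3 - N - ((L : ℂ) ^ 3 - N)) ^ 2).re = 0 := by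
    simp
  rwa [hz] at h

/-- **SECTOR SELECTION.** For `L ≥ 3` and `N ≤ L³`, every ground vector of `H_pen(L,N)` is supported
in the sector `n_up = N` (`#↓ = L³ − N`): the off-sector block of `H_pen` is `≥ L³ > 0 ≥ E₀` by (★),
and `H_pen` does not mix the blocks. (The `d = 3` case of the support item `PenaltySelectsSector` in
vector form; not that item's statement.) [folklore] -/
theorem apply_eq_zero_of_mem_groundSpace (hL : 3 ≤ L) {N : ℕ} (hN : N ≤ L ^ 3)
    {v : TensorIndex (TorusSite 3 L) 2 → ℂ} (hv : v ∈ (Hpen L N).groundSpace)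
    {σ : TensorIndex (TorusSite 3 L) 2} (hσ : downCount σ ≠ L ^ 3 - N) : v σ = 0 := by
  set W : ℕ := L ^ 3 - N with hW
  set w : TensorIndex (TorusSite 3 L) 2 → ℂ := fun τ => if downCount τ = W then 0 else v τ with hw
  set u : TensorIndex (TorusSite 3 L) 2 → ℂ := fun τ => if downCount τ = W then v τ else 0 with hu
  have hvu : v = w + u := by
    ext τ
    simp only [hw, hu, Pi.add_apply]
    split_ifs <;> simp
  have hHu : ∀ τ, downCount τ ≠ W → (Hpen L N *ᵥ u) τ = 0 := by
    intro τ hτ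
    rw [mulVec, dotProduct]
    refine Finset.sum_eq_zero fun ρ _ => ?_
    by_cases hρ : downCount ρ = W
    · rw [Hpen_apply_eq_zero_of_downCount_ne L N (by rw [hρ]; exact hτ), zero_mul]
    · simp [hu, hρ]
  have hwHu : star w ⬝ᵥ (Hpen L N *ᵥ u) = 0 := by
    rw [dotProduct]
    refine Finset.sum_eq_zero fun τ _ => ?_
    by_cases hτ : downCount τ = W
    · simp [hw, hτ]
    · rw [hHu τ hτ, mul_zero]
  have hwv : star w ⬝ᵥ v = star w ⬝ᵥ w := by
    rw [dotProduct, dotProduct]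
    refine Finset.sum_congr rfl fun τ _ => ?_
    by_cases hτ : downCount τ = W <;> simp [hw, hτ]
  rw [mem_groundSpace_iff] at hv
  have hq : (star w ⬝ᵥ (Hpen L N) *ᵥ w).re = (Hpen L N).groundEnergy * (star w ⬝ᵥ w).re := by
    have h1 : star w ⬝ᵥ (Hpen L N) *ᵥ v = star w ⬝ᵥ (Hpen L N) *ᵥ w := by
      rw [hvu, mulVec_add, dotProduct_add, hwHu, add_zero]
    rw [← h1, hv, dotProduct_smul, hwv, smul_eq_mul, Complex.re_ofReal_mul]
  have hE0 := groundEnergy_Hpen_nonpos L hN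
  have hww : 0 ≤ (star w ⬝ᵥ w).re := (Complex.nonneg_iff.mp (dotProduct_star_self_nonneg _)).1
  have hquad : (star w ⬝ᵥ (Hpen L N) *ᵥ w).re ≤ 0 := by
    rw [hq]
    exact mul_nonpos_of_nonpos_of_nonneg hE0 hww
  have hM := re_quad_Hpen_ge L hL N w
  have hcard : ((L ^ 3 : ℕ) : ℝ) = (L : ℝ) ^ 3 := by push_cast; ring
  have hterm : ∀ τ : TensorIndex (TorusSite 3 L) 2, (L : ℝ) ^ 3 * ‖w τ‖ ^ 2 ≤
      (4 * (L : ℝ) ^ 3 * ((L : ℝ) ^ 3 - N - downCount τ) ^ 2 - 3 * downCount τ) * ‖w τ‖ ^ 2 := by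
    intro τ
    by_cases hτ : downCount τ = W
    · have : w τ = 0 := by simp [hw, hτ]
      rw [this, norm_zero]
      simp
    · apply mul_le_mul_of_nonneg_right _ (sq_nonneg _)
      have hk : (downCount τ : ℝ) ≤ (L : ℝ) ^ 3 := by
        rw [← hcard, ← card_site L]
        exact_mod_cast downCount_le_card τ
      have hsq : (1 : ℝ) ≤ ((L : ℝ) ^ 3 - N - downCount τ) ^ 2 := by
        have hWr : ((W : ℕ) : ℝ) = (L : ℝ) ^ 3 - N := by rw [hW, Nat.cast_sub hN, hcard]
        rw [← hWr]
        rcases lt_or_gt_of_ne hτ with hlt | hgt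
        · have : (downCount τ : ℝ) + 1 ≤ W := by exact_mod_cast hlt
          nlinarith
        · have : (W : ℝ) + 1 ≤ downCount τ := by exact_mod_cast hgt
          nlinarith
      have hL0 : (0 : ℝ) ≤ (L : ℝ) ^ 3 := by positivity
      nlinarith
  have hsum : (L : ℝ) ^ 3 * ∑ τ, ‖w τ‖ ^ 2 ≤ 0 := by
    rw [Finset.mul_sum]
    exact (Finset.sum_le_sum fun τ _ => hterm τ).trans (hM.trans hquad)
  have hL3 : (0 : ℝ) < (L : ℝ) ^ 3 := by
    have : (3 : ℝ) ≤ L := by exact_mod_cast hL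
    positivity
  have hS0 : ∑ τ, ‖w τ‖ ^ 2 ≤ 0 := by
    by_contra hcon
    push Not at hcon
    nlinarith
  have hnn : ∀ τ ∈ (Finset.univ : Finset (TensorIndex (TorusSite 3 L) 2)), 0 ≤ ‖w τ‖ ^ 2 :=
    fun τ _ => sq_nonneg _
  have hzero := (Finset.sum_eq_zero_iff_of_nonneg hnn).mp (le_antisymm hS0 (Finset.sum_nonneg hnn))
  have hwσ : w σ = v σ := by simp [hw, hσ]
  have h0 := hzero σ (Finset.mem_univ σ)
  rw [hwσ] at h0
  exact norm_eq_zero.mp (sq_eq_zero_iff.mp h0)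

/-- **Tóth's in-sector ceiling for the tracial ground state**: `Re ω(O) ≤ N(L³ − N) + L³/2`
(`L ≥ 3`, `N ≤ L³`). [folklore] -/
theorem re_gsf_obsO_le_sector (hL : 3 ≤ L) {N : ℕ} (hN : N ≤ L ^ 3) :
    ((Hpen L N).groundStateFunctional (obsO (TorusSite 3 L))).re ≤
      (N : ℝ) * ((L : ℝ) ^ 3 - N) + (L : ℝ) ^ 3 / 2 := by
  set B : ℝ := (N : ℝ) * ((L : ℝ) ^ 3 - N) + (L : ℝ) ^ 3 / 2 with hB
  have hT : ∀ v ∈ (Hpen L N).groundSpace,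
      0 ≤ (star v ⬝ᵥ (((B : ℝ) : ℂ) • (1 : Op (TorusSite 3 L) 2) - obsO (TorusSite 3 L)) *ᵥ v).re := by
    intro v hv
    have h := re_quad_obsO_le_of_support (L ^ 3 - N) v
      (fun τ hτ => apply_eq_zero_of_mem_groundSpace L hL hN hv hτ)
    rw [card_site, Nat.cast_sub hN] at h
    push_cast at h
    rw [sub_mulVec, dotProduct_sub, Complex.sub_re, smul_mulVec, one_mulVec, dotProduct_smul,
      smul_eq_mul, Complex.re_ofReal_mul]
    have hB' : ((L : ℝ) ^ 3 - N) * ((L : ℝ) ^ 3 - ((L : ℝ) ^ 3 - N)) + (L : ℝ) ^ 3 / 2 = B := by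
      rw [hB]; ring
    rw [hB'] at h
    linarith
  have h := re_gsf_nonneg_of_groundSpace hT
  rw [map_sub, map_smul, groundStateFunctional_one (Hpen_isHermitian L _), Complex.sub_re,
    smul_eq_mul, mul_one, Complex.ofReal_re] at h
  linarith

/-- **TÓTH'S BOUND** `rhs(L,N) ≤ N(L³ − N + 1)` (Tóth1991: `λ_max(γ_N) ≤ N(|Λ| − N + 1)/|Λ|` for
hard-core lattice bosons), here for the tracial ground state of the penalised Hamiltonian
(`L ≥ 3`, `N ≤ L³`). At `N = 1` it is attained by the uniform one-particle ground state
(`rhs(L,1) = L³`, i.e. `N₀ = 1`; ED job j013112 confirms `N₀/N = 1.00000` at `N = 1`). [folklore] -/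
theorem rhs_le_toth (hL : 3 ≤ L) {N : ℕ} (hN : N ≤ L ^ 3) :
    rhs L N ≤ (N : ℝ) * ((L : ℝ) ^ 3 - N + 1) := by
  rw [rhs]
  have := re_gsf_obsO_le_sector L hL hN
  linarith

end Sector

/-- The crux with the half-filling cap `2N ≤ L³` replaced by a FIXED hole number: `N + K ≤ L³`.
-/
def KineticLatticeBECWithHoleCap (K : ℕ) : Prop :=
  ∃ c : ℝ, 0 < c ∧ ∃ L₀ : ℕ, ∀ (L : ℕ) [NeZero L], L₀ ≤ L → Even L → ∀ N : ℕ, 1 ≤ N → N + K ≤ L ^ 3 →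
    c * N * (L : ℝ) ^ 3 ≤ rhs L N

/-- **Every fixed-hole cap is refuted**: for each `K`, uniform BEC at all fillings `N ≤ L³ − K` is
FALSE — at `N = L³ − K`, `rhs = rhs(L,K) + L³ − 2K ≤ K(L³−K+1) + L³ − 2K ≤ (K+1)L³` (particle–hole
+ Tóth) against `c(L³ − K)L³`. The filling hypothesis is load-bearing at linear order in `L³`
(contrast `kineticLatticeBEC_iff_cap`). [folklore] -/
theorem kineticLatticeBEC_false_withHoleCap (K : ℕ) : ¬ KineticLatticeBECWithHoleCap K := by
  rintro ⟨c, hc, L₀, h⟩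
  obtain ⟨m, hm⟩ := exists_nat_gt ((K + 1) / c)
  set n : ℕ := L₀ + K + m + 2 with hn
  have hL0 : 2 * n ≠ 0 := by omega
  haveI : NeZero (2 * n) := ⟨hL0⟩
  have hL3 : 3 ≤ 2 * n := by omega
  have hcube : 2 * n ≤ (2 * n) ^ 3 := by
    calc 2 * n = (2 * n) ^ 1 := (pow_one _).symm
      _ ≤ (2 * n) ^ 3 := Nat.pow_le_pow_right (by omega) (by norm_num)
  have hK : K + 1 ≤ (2 * n) ^ 3 := by omega
  have hN1 : 1 ≤ (2 * n) ^ 3 - K := by omega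
  have hNK : (2 * n) ^ 3 - K + K ≤ (2 * n) ^ 3 := by omega
  have key := h (2 * n) (by omega) ⟨n, two_mul n⟩ ((2 * n) ^ 3 - K) hN1 hNK
  have hKle : K ≤ (2 * n) ^ 3 := by omega
  have hph := rhs_particle_hole (2 * n) hL3 (Nat.sub_le _ K)
  rw [Nat.sub_sub_self hKle] at hph
  have htoth := rhs_le_toth (2 * n) hL3 hKle
  set x : ℝ := ((2 * n : ℕ) : ℝ) with hx
  have hcast : (((2 * n) ^ 3 - K : ℕ) : ℝ) = x ^ 3 - K := by
    rw [Nat.cast_sub hKle, Nat.cast_pow]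
  rw [hcast] at key hph
  -- key : c (x³ − K) x³ ≤ rhs(L, L³−K) = rhs(L,K) + 2(x³−K) − x³ ≤ K(x³−K+1) + x³ − 2K
  have hxm : (K : ℝ) + m + 2 ≤ x := by
    rw [hx, hn]; push_cast; linarith
  have hK0 : (0 : ℝ) ≤ K := Nat.cast_nonneg _
  have hm0 : (0 : ℝ) ≤ m := Nat.cast_nonneg _
  have hx1 : (1 : ℝ) ≤ x := by linarith
  have hx3 : x ≤ x ^ 3 := le_self_pow₀ hx1 (by norm_num)
  have hxpos : (0 : ℝ) < x ^ 3 := by positivity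
  have hcm : (K : ℝ) + 1 < c * m := by
    rw [div_lt_iff₀ hc] at hm
    linarith
  -- rhs(L, L³ − K) ≤ (K + 1) x³
  have hbound : rhs (2 * n) ((2 * n) ^ 3 - K) ≤ ((K : ℝ) + 1) * x ^ 3 := by
    rw [hph]
    nlinarith
  -- c (x³ − K) x³ ≤ (K+1) x³  ⇒  c (x³ − K) ≤ K + 1
  have h1 : c * (x ^ 3 - K) ≤ K + 1 := by
    have : x ^ 3 * (c * (x ^ 3 - K)) ≤ x ^ 3 * (K + 1) := by nlinarith
    exact le_of_mul_le_mul_left this hxpos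
  -- but x³ − K ≥ x − K ≥ m + 2, so c (x³ − K) ≥ c (m + 2) > K + 1
  have h2 : (m : ℝ) + 2 ≤ x ^ 3 - K := by linarith
  nlinarith [mul_le_mul_of_nonneg_left h2 hc.le]


/-! ### §6 FOR THE PROVERS: the crux as a lower bound on `‖S⁺_tot v‖²` over sector ground vectors

By §5 every ground vector `v` of `H_pen(L,N)` lies in the `N`-sector, where
`Re⟨v, O v⟩ = ‖S⁺_tot v‖² + (N − L³/2)‖v‖²` (`re_quad_obsO_eq_of_support`), so
`rhs(L,N) = avg_v ‖S⁺_tot v‖²/‖v‖² + 2N − L³` over the ground space (`= ‖S⁻_tot v‖²/‖v‖² = L³N₀` by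
`[S⁺_tot, S⁻_tot] = 2S³_tot`). Positivity transfer turns any UNIFORM lower bound over ground vectors into
the crux (`kineticLatticeBEC_of_groundVector_bound`); the converse needs Perron uniqueness of the sector
ground state (support item `SectorGroundStatePerron`), since a tracial average does not bound each
ground vector. This positive reduction lives only in this work file (not on the Negative lane). -/

section Provers

variable (L : ℕ) [NeZero L]

/-- **In the sector, `Re⟨v, O v⟩ = ‖S⁺_tot v‖² + (N − L³/2)‖v‖²`.** [folklore] -/
theorem re_quad_obsO_eq_of_support {N : ℕ} (hN : N ≤ L ^ 3) (v : TensorIndex (TorusSite 3 L) 2 → ℂ)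
    (hv : ∀ τ, downCount τ ≠ L ^ 3 - N → v τ = 0) :
    (star v ⬝ᵥ (obsO (TorusSite 3 L)) *ᵥ v).re =
      (star ((∑ x, E x) *ᵥ v) ⬝ᵥ ((∑ x, E x) *ᵥ v)).re + ((N : ℝ) - (L : ℝ) ^ 3 / 2) * (star v ⬝ᵥ v).re := by
  rw [quad_obsO, Complex.add_re, re_quad_totalSpin_two, re_star_dotProduct_self v, Finset.mul_sum]
  congr 1
  refine Finset.sum_congr rfl fun τ _ => ?_
  by_cases hτ : downCount τ = L ^ 3 - N
  · rw [hτ, card_site, Nat.cast_sub hN]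
    push_cast
    ring
  · rw [hv τ hτ, norm_zero]
    simp

/-- **Lower-bound transfer.** If every ground vector `v` of `H_pen(L,N)` has `B‖v‖² ≤ ‖S⁺_tot v‖²`,
then `B + 2N − L³ ≤ rhs(L,N)` (`L ≥ 3`, `N ≤ L³`). [folklore] -/
theorem le_rhs_of_groundSpace_bound (hL : 3 ≤ L) {N : ℕ} (hN : N ≤ L ^ 3) {B : ℝ}
    (h : ∀ v ∈ (Hpen L N).groundSpace,
      B * (star v ⬝ᵥ v).re ≤ (star ((∑ x, E x) *ᵥ v) ⬝ᵥ ((∑ x, E x) *ᵥ v)).re) :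
    B + 2 * N - (L : ℝ) ^ 3 ≤ rhs L N := by
  have hT : ∀ v ∈ (Hpen L N).groundSpace,
      0 ≤ (star v ⬝ᵥ (obsO (TorusSite 3 L) -
        (((B + N - (L : ℝ) ^ 3 / 2 : ℝ)) : ℂ) • (1 : Op (TorusSite 3 L) 2)) *ᵥ v).re := by
    intro v hv
    have hq := re_quad_obsO_eq_of_support L hN v
      (fun τ hτ => apply_eq_zero_of_mem_groundSpace L hL hN hv hτ)
    have hb := h v hv
    rw [sub_mulVec, dotProduct_sub, Complex.sub_re, smul_mulVec, one_mulVec, dotProduct_smul,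
      smul_eq_mul, Complex.re_ofReal_mul, hq]
    nlinarith
  have h0 := re_gsf_nonneg_of_groundSpace hT
  rw [map_sub, map_smul, groundStateFunctional_one (Hpen_isHermitian L _), Complex.sub_re,
    smul_eq_mul, mul_one, Complex.ofReal_re] at h0
  rw [rhs]
  linarith

/-- **A sufficient condition for the crux** (how a prover closes it through this file): a uniform
bound `(c·N·L³ + L³ − 2N)‖v‖² ≤ ‖S⁺_tot v‖²` for every ground vector `v` of `H_pen(L,N)` on large even
tori and `1 ≤ N ≤ L³/2` implies `KineticLatticeBEC`. (Equivalently `c·N·L³·‖v‖² ≤ ‖S⁻_tot v‖²`,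
the zero-mode occupation form.) [folklore] -/
theorem kineticLatticeBEC_of_groundVector_bound
    (h : ∃ c : ℝ, 0 < c ∧ ∃ L₀ : ℕ, ∀ (L : ℕ) [NeZero L], L₀ ≤ L → Even L → ∀ N : ℕ, 1 ≤ N →
      2 * N ≤ L ^ 3 → ∀ v ∈ (Hpen L N).groundSpace,
        (c * N * (L : ℝ) ^ 3 + (L : ℝ) ^ 3 - 2 * N) * (star v ⬝ᵥ v).re ≤
          (star ((∑ x, E x) *ᵥ v) ⬝ᵥ ((∑ x, E x) *ᵥ v)).re) :
    KineticLatticeBEC := by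
  obtain ⟨c, hc, L₀, h⟩ := h
  refine kineticLatticeBEC_iff.mpr ⟨c, hc, max L₀ 3, fun L _ hL hE N hN1 h2N => ?_⟩
  have hL₀ : L₀ ≤ L := le_trans (le_max_left _ _) hL
  have hL3 : 3 ≤ L := le_trans (le_max_right _ _) hL
  have hN : N ≤ L ^ 3 := by omega
  have := le_rhs_of_groundSpace_bound L hL3 hN (h L hL₀ hE N hN1 h2N)
  linarith

end Provers


/-! ### §7 The hypothesis `1 ≤ N` is NOT load-bearing: `rhs(L,L³) = L³` and `rhs(L,0) = 0` exactly -/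

section ZeroFilling

variable (L : ℕ) [NeZero L]

/-- **`rhs(L,L³) = L³` exactly** (`N₀ = 1` at full filling; `L ≥ 3`). [folklore] -/
theorem rhs_full (hL : 3 ≤ L) : rhs L (L ^ 3) = (L : ℝ) ^ 3 := by
  refine le_antisymm (rhs_full_le L hL) ?_
  have h := le_rhs_of_groundSpace_bound L hL (le_refl (L ^ 3)) (B := 0) (fun v _ => by
    rw [zero_mul]
    exact (Complex.nonneg_iff.mp (dotProduct_star_self_nonneg _)).1)
  push_cast at h
  linarith

/-- **`rhs(L,0) = 0`** (empty lattice; `L ≥ 3`), by particle–hole symmetry. [folklore] -/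
theorem rhs_zero (hL : 3 ≤ L) : rhs L 0 = 0 := by
  have h := rhs_particle_hole L hL (Nat.zero_le (L ^ 3))
  rw [Nat.sub_zero, rhs_full L hL] at h
  push_cast at h
  linarith

/-- The `N = 0` instance of the crux inequality is `0 ≤ 0`: dropping `1 ≤ N` changes nothing.
[folklore] -/
theorem crux_ineq_zero (hL : 3 ≤ L) (c : ℝ) : c * ((0 : ℕ) : ℝ) * (L : ℝ) ^ 3 ≤ rhs L 0 := by
  rw [rhs_zero L hL]
  simp

end ZeroFilling


end Summit.AtomisticToContinuum.BoseEinsteinCondensation.Cruxes.KineticLatticeBEC.Disproof
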